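import Mathlib
import Summits.Ventures.PercRepro2.Defs
import Summits.Ventures.PercRepro2.CoinDefs

/-!
# Deleting the arcs out of a vertex set; the out-coins of a sink vertex (blind cell PercRepro2,
night-2)

Tools for the sink case of row 2′DARC (proofs/NIGHT2-DARC.md §8, `CoinSink.lean`):
* `arcsOff arcs Z` — the arc map with every arc whose tail lies in `Z` deleted; `reach_split`: a path
  of the original map either lives in the reduced map or reaches a vertex of `Z` inside the reduced
  map and then uses an open arc out of it; hence avoidance events containing `Z` and the markers on
  them are the same for both maps (`avoidEvent_arcsOff`, `reach_iff_of_avoid`), and reduced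
  reachability only depends on the coins where the reduced map is nonempty (`reach_arcsOff_congr`);
* `outCoins arcs w`, `outClosed arcs w` (all out-coins of `w` closed), `IsSinkInto arcs w T` (every arc
  out of `w` lands in `T`), `OutCoinsTailsIn` (the out-coins of `w` carry only tails in `insert w T`,
  true for single arcs and antiparallel pairs);
* the SINK DECOMPOSITIONS `gateEvent_sink_decomp` and `avoidEvent_sink_decomp`: with all out-coins
  closed the gate is `R_T`; with some out-coin open `w → T` is deterministic and the gate is the
  S-avoidance event `R_{T ∪ {u, w}}` while `R_T` is `R_{T ∪ {w}}`.
-/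

namespace Summit.Ventures.PercRepro2.Coin

/-! ## Deleting the arcs out of a vertex set -/

section ArcsOff

variable {V : Type*} {E : Type*} [DecidableEq V]

/-- The arc map with every arc whose tail lies in `Z` deleted. -/
def arcsOff (arcs : E → Finset (V × V)) (Z : Finset V) : E → Finset (V × V) :=
  fun e => (arcs e).filter (fun xy => xy.1 ∉ Z)

/-- An open arc of the reduced map is an open arc of the original map with tail outside `Z`. -/
lemma openArc_arcsOff {arcs : E → Finset (V × V)} {Z : Finset V} {ω : Config E} {x y : V}
    (h : OpenArc (arcsOff arcs Z) ω x y) : OpenArc arcs ω x y ∧ x ∉ Z := by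
  obtain ⟨e, he, hxy⟩ := h
  simp only [arcsOff, Finset.mem_filter] at hxy
  exact ⟨⟨e, he, hxy.1⟩, hxy.2⟩

/-- Reachability in the reduced map implies reachability in the original map. -/
lemma reach_of_reach_arcsOff {arcs : E → Finset (V × V)} {Z : Finset V} {ω : Config E} {x y : V}
    (h : Reach (arcsOff arcs Z) ω x y) : Reach arcs ω x y := by
  induction h with
  | refl => exact reach_refl arcs ω x
  | tail _ hstep ih => exact reach_trans ih (reach_of_openArc (openArc_arcsOff hstep).1)

/-- **Path splitting.** A path of the original map either lives in the reduced map or reaches a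
vertex of `Z` (inside the reduced map) and then uses an open arc out of it. -/
lemma reach_split {arcs : E → Finset (V × V)} (Z : Finset V) {ω : Config E} {x y : V}
    (h : Reach arcs ω x y) :
    Reach (arcsOff arcs Z) ω x y ∨
      ∃ z ∈ Z, Reach (arcsOff arcs Z) ω x z ∧ ∃ y', OpenArc arcs ω z y' := by
  induction h with
  | refl => exact Or.inl (reach_refl _ ω x)
  | @tail y' y _ hstep ih =>
    rcases ih with h₀ | h₀
    · by_cases hz : y' ∈ Z
      · exact Or.inr ⟨y', hz, h₀, y, hstep⟩
      · obtain ⟨e, he, hxy⟩ := hstep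
        have hxy' : (y', y) ∈ arcsOff arcs Z e := by
          simp only [arcsOff, Finset.mem_filter]; exact ⟨hxy, hz⟩
        exact Or.inl (Relation.ReflTransGen.tail h₀ ⟨e, he, hxy'⟩)
    · exact Or.inr h₀

/-- On an avoidance event containing `Z`, reachability from `s` is that of the reduced map. -/
lemma reach_iff_of_avoid {arcs : E → Finset (V × V)} {Z X : Finset V} (hZX : Z ⊆ X) {s : V}
    {ω : Config E} (hω : ω ∈ avoidEvent arcs s X) (a : V) :
    Reach arcs ω s a ↔ Reach (arcsOff arcs Z) ω s a := by
  constructor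
  · intro h
    rcases reach_split Z h with h₀ | ⟨z, hz, hsz, _⟩
    · exact h₀
    · exact absurd (reach_of_reach_arcsOff hsz) (hω z (hZX hz))
  · exact reach_of_reach_arcsOff

/-- Avoidance events containing `Z` are the same for the original and the reduced map. -/
lemma avoidEvent_arcsOff (arcs : E → Finset (V × V)) {Z X : Finset V} (hZX : Z ⊆ X) (s : V) :
    avoidEvent arcs s X = avoidEvent (arcsOff arcs Z) s X := by
  ext ω
  constructor
  · intro hω t ht hr
    exact hω t ht (reach_of_reach_arcsOff hr)
  · intro hω t ht hr
    rcases reach_split Z hr with h₀ | ⟨z, hz, hsz, _⟩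
    · exact hω t ht h₀
    · exact hω z (hZX hz) hsz

/-- Reachability in the reduced map only depends on the coins on which the reduced map is nonempty. -/
lemma reach_arcsOff_congr {arcs : E → Finset (V × V)} {Z : Finset V} {ω ω' : Config E}
    (h : ∀ e, arcsOff arcs Z e ≠ ∅ → ω e = ω' e) {x y : V} :
    Reach (arcsOff arcs Z) ω x y ↔ Reach (arcsOff arcs Z) ω' x y := by
  have key : ∀ {p q : V}, OpenArc (arcsOff arcs Z) ω p q ↔ OpenArc (arcsOff arcs Z) ω' p q := by
    intro p q
    constructor
    · rintro ⟨e, he, hpq⟩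
      refine ⟨e, ?_, hpq⟩
      rw [← h e (Finset.ne_empty_of_mem hpq)]; exact he
    · rintro ⟨e, he, hpq⟩
      refine ⟨e, ?_, hpq⟩
      rw [h e (Finset.ne_empty_of_mem hpq)]; exact he
  constructor
  · intro hr
    induction hr with
    | refl => exact Relation.ReflTransGen.refl
    | tail _ hstep ih => exact Relation.ReflTransGen.tail ih (key.mp hstep)
  · intro hr
    induction hr with
    | refl => exact Relation.ReflTransGen.refl
    | tail _ hstep ih => exact Relation.ReflTransGen.tail ih (key.mpr hstep)

end ArcsOff

/-! ## The out-coins of `w`, the closed/open branches -/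

section Sink

variable {V : Type*} {E : Type*} [DecidableEq V]

/-- The out-coins of `w`: coins carrying an arc with tail `w`. -/
def outCoins (arcs : E → Finset (V × V)) (w : V) : Set E := {e | ∃ xy ∈ arcs e, xy.1 = w}

/-- The event that every out-coin of `w` is closed. -/
def outClosed (arcs : E → Finset (V × V)) (w : V) : Set (Config E) :=
  {ω | ∀ e ∈ outCoins arcs w, ω e = false}

/-- `w` is a SINK INTO `T`: every arc out of `w` lands in `T`. -/
def IsSinkInto (arcs : E → Finset (V × V)) (w : V) (T : Finset V) : Prop :=
  ∀ e, ∀ xy ∈ arcs e, xy.1 = w → xy.2 ∈ T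

/-- The out-coins of `w` carry only arcs with tails in `insert w T` (true for single arcs and for
antiparallel pairs `{w → t, t → w}`, i.e. on mixed systems with `w` a sink into `T`). -/
def OutCoinsTailsIn (arcs : E → Finset (V × V)) (w : V) (T : Finset V) : Prop :=
  ∀ e ∈ outCoins arcs w, ∀ xy ∈ arcs e, xy.1 ∈ insert w T

/-- The reduced map is empty on the out-coins of `w`. -/
lemma arcsOff_eq_empty_of_outCoins {arcs : E → Finset (V × V)} {w : V} {T : Finset V}
    (hT : OutCoinsTailsIn arcs w T) {e : E} (he : e ∈ outCoins arcs w) :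
    arcsOff arcs (insert w T) e = ∅ := by
  ext xy
  simp only [arcsOff, Finset.mem_filter, Finset.notMem_empty, iff_false, not_and, not_not]
  intro hxy
  exact hT e he xy hxy

omit [DecidableEq V] in
/-- If all out-coins of `w` are closed, `w` reaches only itself. -/
lemma reach_eq_self_of_outClosed {arcs : E → Finset (V × V)} {w : V} {ω : Config E}
    (hC : ω ∈ outClosed arcs w) {y : V} (h : Reach arcs ω w y) : y = w := by
  induction h with
  | refl => rfl
  | tail _ hstep ih =>
    subst ih
    obtain ⟨e, he, hxy⟩ := hstep
    have : ω e = false := hC e ⟨_, hxy, rfl⟩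
    rw [he] at this
    exact absurd this (by decide)

omit [DecidableEq V] in
/-- With all out-coins of `w` closed, `w ∉ K⁻` (for `w ∉ T`). -/
lemma not_bwd_of_outClosed {arcs : E → Finset (V × V)} {w : V} {T : Finset V} (hw : w ∉ T)
    {ω : Config E} (hC : ω ∈ outClosed arcs w) : ω ∉ bwdEvent arcs w T := by
  rintro ⟨t, ht, hr⟩
  have := reach_eq_self_of_outClosed hC hr
  subst this
  exact hw ht

omit [DecidableEq V] in
/-- With some out-coin of `w` open and `w` a sink into `T`, `w ∈ K⁻`. -/
lemma bwd_of_not_outClosed {arcs : E → Finset (V × V)} {w : V} {T : Finset V}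
    (hsink : IsSinkInto arcs w T) {ω : Config E} (hC : ω ∉ outClosed arcs w) :
    ω ∈ bwdEvent arcs w T := by
  simp only [outClosed, Set.mem_setOf_eq, not_forall] at hC
  obtain ⟨e, ⟨xy, hxy, hxw⟩, hne⟩ := hC
  have he : ω e = true := by
    cases h : ω e
    · exact absurd h hne
    · rfl
  refine ⟨xy.2, hsink e xy hxy hxw, ?_⟩
  have : OpenArc arcs ω w xy.2 := ⟨e, he, by rw [← hxw]; exact hxy⟩
  exact reach_of_openArc this

/-- **The sink decomposition of the gate event**: all out-coins of `w` closed and `s ↛ T`, or some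
out-coin open and `s ↛ T ∪ {u, w}`. -/
theorem gateEvent_sink_decomp {arcs : E → Finset (V × V)} {s u w : V} {T : Finset V} (hw : w ∉ T)
    (hsink : IsSinkInto arcs w T) :
    gateEvent arcs s T u w =
      (outClosed arcs w ∩ avoidEvent arcs s T) ∪
        ((outClosed arcs w)ᶜ ∩ avoidEvent arcs s (insert u (insert w T))) := by
  rw [gateEvent_eq_union]
  ext ω
  by_cases hC : ω ∈ outClosed arcs w
  · have hb := not_bwd_of_outClosed hw hC
    simp only [Set.mem_inter_iff, Set.mem_union, Set.mem_compl_iff, hC, not_true_eq_false,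
      false_and, or_false, hb, not_false_eq_true, or_true, and_true, true_and]
  · have hb := bwd_of_not_outClosed hsink hC
    simp only [Set.mem_inter_iff, Set.mem_union, Set.mem_compl_iff, hC, false_and, false_or,
      hb, not_true_eq_false, or_false, not_false_eq_true, true_and]
    constructor
    · rintro ⟨hR, hu⟩ t ht
      simp only [Finset.mem_insert] at ht
      rcases ht with rfl | rfl | ht
      · exact hu
      · intro hsw
        obtain ⟨t', ht', hwt⟩ := hb
        exact hR t' ht' (reach_trans hsw hwt)
      · exact hR t ht
    · intro h
      exact ⟨fun t ht => h t (by simp [ht]), h u (by simp)⟩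

/-- **The sink decomposition of `R_T`.** -/
theorem avoidEvent_sink_decomp {arcs : E → Finset (V × V)} {s w : V} {T : Finset V}
    (hsink : IsSinkInto arcs w T) :
    avoidEvent arcs s T =
      (outClosed arcs w ∩ avoidEvent arcs s T) ∪
        ((outClosed arcs w)ᶜ ∩ avoidEvent arcs s (insert w T)) := by
  ext ω
  by_cases hC : ω ∈ outClosed arcs w
  · simp only [Set.mem_inter_iff, Set.mem_union, Set.mem_compl_iff, hC, not_true_eq_false,
      false_and, or_false, true_and]
  · have hb := bwd_of_not_outClosed hsink hC
    simp only [Set.mem_inter_iff, Set.mem_union, Set.mem_compl_iff, hC, false_and, false_or,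
      not_false_eq_true, true_and]
    constructor
    · intro hR t ht
      simp only [Finset.mem_insert] at ht
      rcases ht with rfl | ht
      · intro hsw
        obtain ⟨t', ht', hwt⟩ := hb
        exact hR t' ht' (reach_trans hsw hwt)
      · exact hR t ht
    · intro h t ht
      exact h t (by simp [ht])

/-- On the closed branch, reachability from `s` on `R_T` is that of the reduced map with
`Z = insert w T`. -/
lemma reach_iff_of_outClosed {arcs : E → Finset (V × V)} {s w : V} {T : Finset V} {ω : Config E}
    (hC : ω ∈ outClosed arcs w) (hR : ω ∈ avoidEvent arcs s T) (a : V) :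
    Reach arcs ω s a ↔ Reach (arcsOff arcs (insert w T)) ω s a := by
  constructor
  · intro h
    rcases reach_split (insert w T) h with h₀ | ⟨z, hz, hsz, y', hzy'⟩
    · exact h₀
    · simp only [Finset.mem_insert] at hz
      rcases hz with rfl | hz
      · obtain ⟨e, he, hxy⟩ := hzy'
        have : ω e = false := hC e ⟨_, hxy, rfl⟩
        rw [he] at this
        exact absurd this (by decide)
      · exact absurd (reach_of_reach_arcsOff hsz) (hR z hz)
  · exact reach_of_reach_arcsOff

/-- On the closed branch `R_T` is the reduced avoidance event. -/
lemma outClosed_inter_avoid {arcs : E → Finset (V × V)} {s w : V} {T : Finset V} :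
    outClosed arcs w ∩ avoidEvent arcs s T =
      outClosed arcs w ∩ avoidEvent (arcsOff arcs (insert w T)) s T := by
  ext ω
  simp only [Set.mem_inter_iff]
  constructor
  · rintro ⟨hC, hR⟩
    exact ⟨hC, fun t ht hr => hR t ht (reach_of_reach_arcsOff hr)⟩
  · rintro ⟨hC, hR⟩
    refine ⟨hC, fun t ht hr => ?_⟩
    rcases reach_split (insert w T) hr with h₀ | ⟨z, hz, hsz, y', hzy'⟩
    · exact hR t ht h₀
    · simp only [Finset.mem_insert] at hz
      rcases hz with rfl | hz
      · obtain ⟨e, he, hxy⟩ := hzy'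
        have : ω e = false := hC e ⟨_, hxy, rfl⟩
        rw [he] at this
        exact absurd this (by decide)
      · exact hR z hz hsz

end Sink

end Summit.Ventures.PercRepro2.Coin
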